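import Mathlib

/-!
# T5AdicCompletionResidueField — the residue field of `adicCompletionIntegers K v` is `R ⧸ v`,
hence FINITE for number fields

Blind cell pub-hodge-repro2, seat p4 (Tier-5 Lean support, annex growth only).
Declaration per README §8(d): uses an L-value-free non-vanishing device: NO.

The farm's Mathlib knows that `O_Kv := v.adicCompletionIntegers K` is a DVR but has no statement
about its residue field. This file proves `R ⧸ v.asIdeal ≃+* IsLocalRing.ResidueField O_Kv`
(`quotientEquivResidueField`) from two Mathlib density facts — `denseRange_algebraMap` (`K` is
dense in `Kv`) and `exists_valuation_sub_lt_of_integer` (`R` is dense in the valuation ring of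
`K` at `v`) — and the kernel computation `a ∈ v.asIdeal ↔ v a < 1`; for a number field `K` the
residue field is therefore FINITE (`Ideal.finiteQuotientOfFreeOfNeBot`), of cardinality the
absolute norm `N(v)` (`card_residueField`). This is the «finite residue field» hypothesis of the
local-field object used by the Haar / Gauss-sum files of this cell, now supplied on Mathlib's
concrete completions. Nothing here is asserted about the Tier-5 datum.
-/

namespace Summit.Ventures.HodgeRepro2.T5AdicCompletionResidueField

open IsDedekindDomain HeightOneSpectrum WithZero IsLocalRing Topology
open scoped WithZero

section General

variable {R : Type*} [CommRing R] [IsDedekindDomain R] {K : Type*} [Field K] [Algebra R K]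
  [IsFractionRing R K] (v : HeightOneSpectrum R)

/-- The maximal ideal of `O_Kv` is the open unit ball `{x | v x < 1}`. -/
theorem mem_maximalIdeal_iff (x : v.adicCompletionIntegers K) :
    x ∈ maximalIdeal (v.adicCompletionIntegers K) ↔ Valued.v (x : v.adicCompletion K) < 1 := by
  rw [IsLocalRing.mem_maximalIdeal, mem_nonunits_iff, adicCompletionIntegers.isUnit_iff_valued_eq_one]
  exact ⟨fun h => lt_of_le_of_ne x.2 h, fun h => h.ne⟩

/-- The open unit ball around `x` is a neighbourhood of `x` in `Kv`. -/
theorem setOf_val_sub_lt_one_mem_nhds (x : v.adicCompletion K) :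
    {z : v.adicCompletion K | Valued.v (z - x) < 1} ∈ 𝓝 x := by
  rw [Valued.mem_nhds]
  exact ⟨1, fun z hz => by
    simpa [Set.mem_setOf_eq, Valuation.restrict_lt_one_iff] using hz⟩

/-- Every element of `O_Kv` is congruent modulo the maximal ideal to a global element of `R`
(`K` is dense in `Kv`, and `R` is dense in the `v`-integers of `K`). -/
theorem exists_sub_algebraMap_mem_maximalIdeal (x : v.adicCompletionIntegers K) :
    ∃ a : R, x - algebraMap R (v.adicCompletionIntegers K) a ∈
      maximalIdeal (v.adicCompletionIntegers K) := by
  -- a global field element `y` within the open unit ball around `x`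
  obtain ⟨U, hUs, hUo, hxU⟩ := mem_nhds_iff.mp (setOf_val_sub_lt_one_mem_nhds v (x : v.adicCompletion K))
  obtain ⟨y, hy⟩ := (denseRange_algebraMap K v).exists_mem_open hUo ⟨x, hxU⟩
  have hyx : Valued.v (algebraMap K (v.adicCompletion K) y - x) < 1 := hUs hy
  have hcoeK : ∀ k : K, algebraMap K (v.adicCompletion K) k = (k : v.adicCompletion K) := fun k => by
    rw [algebraMap_adicCompletion]; rfl
  have hy1' : Valued.v (algebraMap K (v.adicCompletion K) y) ≤ 1 :=
    calc Valued.v (algebraMap K (v.adicCompletion K) y)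
        = Valued.v ((algebraMap K (v.adicCompletion K) y - x) + x) := by rw [sub_add_cancel]
      _ ≤ max (Valued.v (algebraMap K (v.adicCompletion K) y - x)) (Valued.v (x : v.adicCompletion K)) :=
          Valuation.map_add _ _ _
      _ ≤ 1 := max_le hyx.le x.2
  have hy1 : v.valuation K y ≤ 1 := by
    rwa [hcoeK, valuedAdicCompletion_eq_valuation'] at hy1'
  -- a global integer `a` within the open unit ball around `y`
  obtain ⟨a, ha⟩ := exists_valuation_sub_lt_of_integer v hy1 1
  refine ⟨a, (mem_maximalIdeal_iff v _).mpr ?_⟩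
  have ha' : Valued.v (algebraMap R (v.adicCompletion K) a - algebraMap K (v.adicCompletion K) y) < 1 := by
    have : algebraMap R (v.adicCompletion K) a = algebraMap K (v.adicCompletion K) (algebraMap R K a) := by
      rw [algebraMap_adicCompletion, algebraMap_adicCompletion]; rfl
    rw [this, ← map_sub, algebraMap_adicCompletion, Function.comp_apply,
      valuedAdicCompletion_eq_valuation']
    simpa using ha
  have hcoeR : algebraMap R (v.adicCompletion K) a = ((algebraMap R K a : K) : v.adicCompletion K) := by
    rw [algebraMap_adicCompletion]; rfl
  have hcoe : ((x - algebraMap R (v.adicCompletionIntegers K) a : v.adicCompletionIntegers K) :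
      v.adicCompletion K) = x - algebraMap R (v.adicCompletion K) a := by
    rw [hcoeR]; rfl
  rw [hcoe]
  calc Valued.v ((x : v.adicCompletion K) - algebraMap R (v.adicCompletion K) a)
      = Valued.v (-((algebraMap R (v.adicCompletion K) a - algebraMap K (v.adicCompletion K) y) +
          (algebraMap K (v.adicCompletion K) y - x))) := by ring_nf
    _ = Valued.v ((algebraMap R (v.adicCompletion K) a - algebraMap K (v.adicCompletion K) y) +
          (algebraMap K (v.adicCompletion K) y - x)) := Valuation.map_neg _ _
    _ ≤ max _ _ := Valuation.map_add _ _ _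
    _ < 1 := max_lt ha' hyx

/-- The residue map `R → 𝓀(O_Kv)`. -/
noncomputable def residueMap : R →+* ResidueField (v.adicCompletionIntegers K) :=
  (IsLocalRing.residue (v.adicCompletionIntegers K)).comp (algebraMap R (v.adicCompletionIntegers K))

/-- `residueMap` is onto. -/
theorem residueMap_surjective : Function.Surjective (residueMap (K := K) v) := fun q => by
  obtain ⟨x, rfl⟩ := IsLocalRing.residue_surjective q
  obtain ⟨a, ha⟩ := exists_sub_algebraMap_mem_maximalIdeal v x
  refine ⟨a, ?_⟩
  rw [residueMap, RingHom.comp_apply, eq_comm, ← sub_eq_zero, ← map_sub,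
    IsLocalRing.residue_eq_zero_iff]
  exact ha

/-- The kernel of `residueMap` is `v` itself (`a ∈ v ↔ v a < 1`). -/
theorem ker_residueMap : RingHom.ker (residueMap (K := K) v) = v.asIdeal := by
  ext a
  rw [RingHom.mem_ker, residueMap, RingHom.comp_apply, IsLocalRing.residue_eq_zero_iff,
    mem_maximalIdeal_iff, algebraMap_adicCompletionIntegers_apply, valuedAdicCompletion_eq_valuation',
    valuation_of_algebraMap, intValuation_lt_one_iff_mem]

/-- THE RESIDUE FIELD of `O_Kv` is the residue field of `v`: `R ⧸ v ≃+* 𝓀(O_Kv)`. -/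
noncomputable def quotientEquivResidueField :
    R ⧸ v.asIdeal ≃+* ResidueField (v.adicCompletionIntegers K) :=
  (Ideal.quotEquivOfEq (ker_residueMap (K := K) v).symm).trans
    (RingHom.quotientKerEquivOfSurjective (residueMap_surjective (K := K) v))

/-- `𝓀(O_Kv)` is finite whenever `R ⧸ v` is. -/
theorem finite_residueField [Finite (R ⧸ v.asIdeal)] :
    Finite (ResidueField (v.adicCompletionIntegers K)) :=
  Finite.of_equiv _ (quotientEquivResidueField (K := K) v).toEquiv

/-- `|𝓀(O_Kv)| = |R ⧸ v|`. -/
theorem card_residueField_eq :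
    Nat.card (ResidueField (v.adicCompletionIntegers K)) = Nat.card (R ⧸ v.asIdeal) :=
  Nat.card_congr (quotientEquivResidueField (K := K) v).toEquiv.symm

end General

section NumberField

open NumberField

variable {K : Type*} [Field K] [NumberField K] (v : HeightOneSpectrum (𝓞 K))

/-- For a number field, the residue field of `O_Kv` is FINITE. -/
instance instFiniteResidueField : Finite (ResidueField (v.adicCompletionIntegers K)) :=
  haveI : Finite (𝓞 K ⧸ v.asIdeal) := Ideal.finiteQuotientOfFreeOfNeBot v.asIdeal v.ne_bot
  finite_residueField v

/-- `|𝓀(O_Kv)| = N(v)`, the absolute norm of `v`. -/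
theorem card_residueField :
    Nat.card (ResidueField (v.adicCompletionIntegers K)) = Ideal.absNorm v.asIdeal := by
  rw [card_residueField_eq, Ideal.absNorm_apply, Submodule.cardQuot_apply]

end NumberField

end Summit.Ventures.HodgeRepro2.T5AdicCompletionResidueField
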